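import Summits.AtomisticToContinuum.HydrodynamicLimit.Theorems.CollisionIsometryCLTAdaptedWeightCLTBlockHDissipation
import Summits.AtomisticToContinuum.HydrodynamicLimit.Theorems.SuperextensiveClosureCostBlockEntropyBudgetTilt
import Mathlib.Analysis.InnerProductSpace.Calculus
import Mathlib.Analysis.SpecialFunctions.Pow.Deriv

/-!
# Entropy budget (stub `stub_entropyBudget`, line `block-h-dissipation-closure`, crux `AdaptedWeightCLT`,
stmt-AtomisticToContinuum-14868; `--supports`) — helper 1: the Gaussian toolkit on `V3 = ℝ³`

Elementary facts about the unit-mass local Maxwellian `M_{θ,u}(v) = localMaxwellian 1 θ u v =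
(2πθ)^{-3/2} e^{-|v-u|²/(2θ)}` on `V3` that the regularised cell law `cellLaw` of the line is built from
(`gauss h u = M_{h²,u}`, the Gaussian mollifier, and the co-moving floor `M_{θ̄+h²,ū}`):
* positivity (the explicit form uses the tree's `finrank_V3_eq_three`), the peak bound `M_{θ,u} ≤ (2 * Real.pi * h ^ 2) ^ (-(3 : ℝ) / 2) = (2πh²)^{-3/2}` for
  `θ ≥ h²`, the logarithm `log M_{θ,u}(v) = −(3/2) log(2πθ) − |v−u|²/(2θ)`;
* INTEGRABILITY TRANSFER: `∫ M_{θ,u} g dv` is an integral against the Gaussian law `gaussMeasure u θ`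
  (tree: `withDensity_localMaxwellian_eq_gaussMeasure`, `integral_localMaxwellian_smul`), so polynomial weights
  are integrable (Fernique, `IsGaussian.memLp_id`) and `∫ M_{θ,u} |v−u|² = 3θ`, `∫ M_{θ,u} |v−u|⁴ = K θ²`;
* a GAUSSIAN ENVELOPE uniform over `h² ≤ θ ≤ Θ`, `|u| ≤ V`: `M_{θ,u}(v) ≤ C · M_{2Θ,0}(v)`;
* the DERIVATIVE ALONG A CURVE `r ↦ M_{θ(r),u(r)}(v)`:
  `M · (θ' (|v−u|²/(2θ²) − 3/(2θ)) + ⟪v−u, u'⟫/θ)` and its bound for `θ ≥ h²`.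
-/

namespace Summit.AtomisticToContinuum.HydrodynamicLimit.Theorems.BlockHDissipation

open scoped BigOperators Topology Classical MeasureTheory ENNReal InnerProductSpace
open Filter Set MeasureTheory ProbabilityTheory
open Literature.Analysis.FluidPDE
open Summit.AtomisticToContinuum.HydrodynamicLimit.Theorems.ContactSourceDuhamel (T3 V3 Cfg Vel Flow Flows)
open Literature.MathematicalPhysics.KineticTheory (integral_localMaxwellian_smul integral_localMaxwellian_one
  localMaxwellian_pos localMaxwellian_nonneg continuous_localMaxwellian gaussMeasure
  withDensity_localMaxwellian_eq_gaussMeasure integral_norm_sq_stdGaussian)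

noncomputable section

namespace EntropyBudget

/-! ## The explicit Maxwellian on `ℝ³` -/

/-- The PEAK VALUE `(2πh²)^{-3/2}` of the mollifier `G_h` (and of every `M_{θ,u}`, `θ ≥ h²`) is positive. -/
theorem gMax_pos {h : ℝ} (hh : 0 < h) : 0 < (2 * Real.pi * h ^ 2) ^ (-(3 : ℝ) / 2) :=
  Real.rpow_pos_of_pos (by positivity) _

/-- The prefactor `(2πθ)^{-3/2}` is at most `(2 * Real.pi * h ^ 2) ^ (-(3 : ℝ) / 2)` for `θ ≥ h²` (a negative power is antitone). -/
theorem rpow_pref_le_gMax {h θ : ℝ} (hh : 0 < h) (hθ : h ^ 2 ≤ θ) :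
    (2 * Real.pi * θ) ^ (-(3 : ℝ) / 2) ≤ (2 * Real.pi * h ^ 2) ^ (-(3 : ℝ) / 2) :=
  Real.rpow_le_rpow_of_nonpos (by positivity) (mul_le_mul_of_nonneg_left hθ (by positivity))
    (by norm_num)

/-- PEAK BOUND: `M_{θ,u}(v) ≤ (2 * Real.pi * h ^ 2) ^ (-(3 : ℝ) / 2)` for `θ ≥ h² > 0`. -/
theorem lM_le_gMax {h θ : ℝ} (hh : 0 < h) (hθ : h ^ 2 ≤ θ) (u v : V3) :
    localMaxwellian 1 θ u v ≤ (2 * Real.pi * h ^ 2) ^ (-(3 : ℝ) / 2) := by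
  have hθ0 : 0 < θ := lt_of_lt_of_le (by positivity) hθ
  simp only [localMaxwellian, finrank_V3_eq_three, Nat.cast_ofNat, one_mul]
  have h1 : Real.exp (-‖v - u‖ ^ 2 / (2 * θ)) ≤ 1 := by
    rw [Real.exp_le_one_iff, neg_div]
    exact neg_nonpos.2 (by positivity)
  calc (2 * Real.pi * θ) ^ (-(3 : ℝ) / 2) * Real.exp (-‖v - u‖ ^ 2 / (2 * θ))
      ≤ (2 * Real.pi * θ) ^ (-(3 : ℝ) / 2) * 1 :=
        mul_le_mul_of_nonneg_left h1 (Real.rpow_nonneg (by positivity) _)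
    _ ≤ (2 * Real.pi * h ^ 2) ^ (-(3 : ℝ) / 2) := by rw [mul_one]; exact rpow_pref_le_gMax hh hθ

/-- The mollifier is the Maxwellian of temperature `h²`: `gauss h u v = M_{h²,u}(v)` (definitional). -/
theorem gauss_eq (h : ℝ) (u v : V3) : gauss h u v = localMaxwellian 1 (h ^ 2) u v := rfl

/-- `0 < G_h`. -/
theorem gauss_pos {h : ℝ} (hh : 0 < h) (u v : V3) : 0 < gauss h u v :=
  localMaxwellian_pos one_pos (by positivity) u v

/-- `G_h ≤ (2 * Real.pi * h ^ 2) ^ (-(3 : ℝ) / 2)`. -/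
theorem gauss_le_gMax {h : ℝ} (hh : 0 < h) (u v : V3) : gauss h u v ≤ (2 * Real.pi * h ^ 2) ^ (-(3 : ℝ) / 2) :=
  lM_le_gMax hh le_rfl u v

/-- THE LOGARITHM of the Maxwellian, as a two-sided bound (the equality
`log M_{θ,u}(v) = −(3/2) log(2πθ) − |v−u|²/(2θ)` is `KineticFluxLdDecayTilt.log_localMaxwellian` in the tree;
only the bounds are used here): lower half. -/
theorem log_lM_ge' {θ : ℝ} (hθ : 0 < θ) (u v : V3) :
    -(3 / 2) * Real.log (2 * Real.pi * θ) - ‖v - u‖ ^ 2 / (2 * θ) ≤ Real.log (localMaxwellian 1 θ u v) := by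
  have h2 : 0 < 2 * Real.pi * θ := by positivity
  simp only [localMaxwellian, finrank_V3_eq_three, Nat.cast_ofNat, one_mul]
  rw [Real.log_mul (Real.rpow_pos_of_pos h2 _).ne' (Real.exp_pos _).ne', Real.log_rpow h2, Real.log_exp]
  apply le_of_eq
  ring

/-- Upper half: `log M_{θ,u}(v) ≤ −(3/2) log(2πθ) − |v−u|²/(2θ)`. -/
theorem log_lM_le' {θ : ℝ} (hθ : 0 < θ) (u v : V3) :
    Real.log (localMaxwellian 1 θ u v) ≤ -(3 / 2) * Real.log (2 * Real.pi * θ) - ‖v - u‖ ^ 2 / (2 * θ) := by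
  have h2 : 0 < 2 * Real.pi * θ := by positivity
  simp only [localMaxwellian, finrank_V3_eq_three, Nat.cast_ofNat, one_mul]
  rw [Real.log_mul (Real.rpow_pos_of_pos h2 _).ne' (Real.exp_pos _).ne', Real.log_rpow h2, Real.log_exp]
  apply le_of_eq
  ring

/-- LOWER BOUND OF THE LOGARITHM for `θ ≥ h²`: `log M_{θ,u}(v) ≥ −(3/2) log(2πθ) − |v−u|²/(2h²)`. -/
theorem log_lM_ge {h θ : ℝ} (hh : 0 < h) (hθ : h ^ 2 ≤ θ) (u v : V3) :
    -(3 / 2) * Real.log (2 * Real.pi * θ) - ‖v - u‖ ^ 2 / (2 * h ^ 2) ≤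
      Real.log (localMaxwellian 1 θ u v) := by
  have hθ0 : 0 < θ := lt_of_lt_of_le (by positivity) hθ
  have : ‖v - u‖ ^ 2 / (2 * θ) ≤ ‖v - u‖ ^ 2 / (2 * h ^ 2) :=
    div_le_div_of_nonneg_left (by positivity) (by positivity) (by linarith)
  linarith [log_lM_ge' hθ0 u v]

/-! ## Integrability transfer to the Gaussian law -/

/-- The Maxwellian is measurable in the velocity. -/
theorem measurable_lM (θ : ℝ) (u : V3) : Measurable (localMaxwellian 1 θ u) :=
  (continuous_localMaxwellian 1 θ u).measurable

/-- INTEGRABILITY TRANSFER: `M_{θ,u} · g` is Lebesgue integrable as soon as `g` is integrable for the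
Gaussian law `gaussMeasure u θ` (`M_{θ,u} dv = gaussMeasure u θ`). -/
theorem integrable_lM_mul {θ : ℝ} (hθ : 0 < θ) (u : V3) {g : V3 → ℝ} (hg : Integrable g (gaussMeasure u θ)) :
    Integrable (fun v => localMaxwellian 1 θ u v * g v) := by
  rw [← withDensity_localMaxwellian_eq_gaussMeasure hθ u] at hg
  have h := (integrable_withDensity_iff_integrable_smul' (μ := volume)
    (f := fun v => ENNReal.ofReal (localMaxwellian 1 θ u v)) (measurable_lM θ u).ennreal_ofReal
    (Eventually.of_forall fun _ => ENNReal.ofReal_lt_top)).1 hg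
  refine h.congr (Eventually.of_forall fun v => ?_)
  simp only [smul_eq_mul, ENNReal.toReal_ofReal (localMaxwellian_nonneg zero_le_one hθ.le u v)]

/-- Powers of the norm are integrable for the Gaussian law (Fernique). -/
theorem integrable_norm_pow_gaussMeasure (u : V3) (θ : ℝ) (k : ℕ) :
    Integrable (fun v : V3 => ‖v‖ ^ k) (gaussMeasure u θ) :=
  (IsGaussian.memLp_id (gaussMeasure u θ) k (ENNReal.natCast_ne_top k)).integrable_norm_pow'

/-- Powers of the distance to a point are integrable for the Gaussian law. -/
theorem integrable_norm_sub_pow_gaussMeasure (u c : V3) (θ : ℝ) (k : ℕ) :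
    Integrable (fun v : V3 => ‖v - c‖ ^ k) (gaussMeasure u θ) := by
  have h1 : Integrable (fun v : V3 => (2 : ℝ) ^ k * (‖v‖ ^ k + ‖c‖ ^ k)) (gaussMeasure u θ) :=
    ((integrable_norm_pow_gaussMeasure u θ k).add (integrable_const _)).const_mul _
  refine h1.mono' ((continuous_id.sub continuous_const).norm.pow k).aestronglyMeasurable
    (Eventually.of_forall fun v => ?_)
  rw [Real.norm_eq_abs, abs_of_nonneg (by positivity)]
  calc ‖v - c‖ ^ k ≤ (‖v‖ + ‖c‖) ^ k := pow_le_pow_left₀ (norm_nonneg _) (norm_sub_le v c) k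
    _ ≤ 2 ^ (k - 1) * (‖v‖ ^ k + ‖c‖ ^ k) := add_pow_le (norm_nonneg _) (norm_nonneg _) k
    _ ≤ 2 ^ k * (‖v‖ ^ k + ‖c‖ ^ k) :=
        mul_le_mul_of_nonneg_right (pow_le_pow_right₀ one_le_two (Nat.sub_le k 1)) (by positivity)

/-- `M_{θ,u}(v) |v − c|^k` is Lebesgue integrable. -/
theorem integrable_lM_mul_norm_sub_pow {θ : ℝ} (hθ : 0 < θ) (u c : V3) (k : ℕ) :
    Integrable (fun v => localMaxwellian 1 θ u v * ‖v - c‖ ^ k) :=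
  integrable_lM_mul hθ u (integrable_norm_sub_pow_gaussMeasure u c θ k)

/-- `M_{θ,u}(v) |v|^k` is Lebesgue integrable. -/
theorem integrable_lM_mul_norm_pow {θ : ℝ} (hθ : 0 < θ) (u : V3) (k : ℕ) :
    Integrable (fun v => localMaxwellian 1 θ u v * ‖v‖ ^ k) :=
  integrable_lM_mul hθ u (integrable_norm_pow_gaussMeasure u θ k)

/-- The Maxwellian is Lebesgue integrable (`k = 0`). -/
theorem integrable_lM {θ : ℝ} (hθ : 0 < θ) (u : V3) : Integrable (localMaxwellian 1 θ u) := by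
  simpa using integrable_lM_mul_norm_pow hθ u 0

/-- Unit mass: `∫ M_{θ,u} = 1`. -/
theorem integral_lM {θ : ℝ} (hθ : 0 < θ) (u : V3) : ∫ v, localMaxwellian 1 θ u v = 1 :=
  integral_localMaxwellian_one hθ u

/-- FOURTH CENTRAL MOMENT: `∫ M_{θ,u}(v) |v − u|⁴ dv = K₄ θ²` with the finite constant
`K₄ = ∫ |w|⁴ dγ(w)` of the standard Gaussian of `ℝ³`. -/
theorem integral_lM_mul_norm_sub_pow_four {θ : ℝ} (hθ : 0 < θ) (u : V3) :
    ∫ v, localMaxwellian 1 θ u v * ‖v - u‖ ^ 4 = (∫ w, ‖w‖ ^ 4 ∂stdGaussian V3) * θ ^ 2 := by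
  have h := integral_localMaxwellian_smul (E := V3) hθ u (fun v => ‖v - u‖ ^ 4)
  simp only [smul_eq_mul, add_sub_cancel_left, norm_smul, mul_pow, Real.norm_eq_abs,
    abs_of_nonneg (Real.sqrt_nonneg θ)] at h
  have h4 : Real.sqrt θ ^ 4 = θ ^ 2 := by
    rw [show (4 : ℕ) = 2 * 2 from rfl, pow_mul, Real.sq_sqrt hθ.le]
  rw [h, h4, integral_const_mul, mul_comm]

/-- SECOND MOMENT ABOUT ANY POINT: `∫ M_{θ,u}(v) |v − c|² dv = 3θ + |u − c|²` (the cross term has zero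
Gaussian mean). -/
theorem integral_lM_mul_norm_sub_sq' {θ : ℝ} (hθ : 0 < θ) (u c : V3) :
    ∫ v, localMaxwellian 1 θ u v * ‖v - c‖ ^ 2 = 3 * θ + ‖u - c‖ ^ 2 := by
  have h := integral_localMaxwellian_smul (E := V3) hθ u (fun v => ‖v - c‖ ^ 2)
  simp only [smul_eq_mul] at h
  rw [h]
  have hexp : ∀ w : V3, ‖u + Real.sqrt θ • w - c‖ ^ 2 =
      ‖u - c‖ ^ 2 + 2 * Real.sqrt θ * ⟪u - c, w⟫_ℝ + θ * ‖w‖ ^ 2 := by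
    intro w
    have : u + Real.sqrt θ • w - c = (u - c) + Real.sqrt θ • w := by abel
    rw [this, norm_add_sq_real, real_inner_smul_right, norm_smul, Real.norm_eq_abs,
      abs_of_nonneg (Real.sqrt_nonneg θ), mul_pow, Real.sq_sqrt hθ.le]
    ring
  simp_rw [hexp]
  have hi1 : Integrable (fun w : V3 => 2 * Real.sqrt θ * ⟪u - c, w⟫_ℝ) (stdGaussian V3) :=
    (IsGaussian.integrable_fun_id.const_inner (u - c)).const_mul _
  have hi2 : Integrable (fun w : V3 => θ * ‖w‖ ^ 2) (stdGaussian V3) :=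
    (Literature.MathematicalPhysics.KineticTheory.integrable_norm_sq_stdGaussian).const_mul _
  have hi0 : Integrable (fun _ : V3 => ‖u - c‖ ^ 2) (stdGaussian V3) := integrable_const _
  have e1 : ∫ w, ‖u - c‖ ^ 2 + 2 * Real.sqrt θ * ⟪u - c, w⟫_ℝ + θ * ‖w‖ ^ 2 ∂stdGaussian V3 =
      (∫ w, ‖u - c‖ ^ 2 + 2 * Real.sqrt θ * ⟪u - c, w⟫_ℝ ∂stdGaussian V3) + ∫ w, θ * ‖w‖ ^ 2 ∂stdGaussian V3 :=
    integral_add (hi0.add hi1) hi2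
  have e2 : ∫ w, ‖u - c‖ ^ 2 + 2 * Real.sqrt θ * ⟪u - c, w⟫_ℝ ∂stdGaussian V3 =
      (∫ _w, ‖u - c‖ ^ 2 ∂stdGaussian V3) + ∫ w, 2 * Real.sqrt θ * ⟪u - c, w⟫_ℝ ∂stdGaussian V3 :=
    integral_add hi0 hi1
  rw [e1, e2, integral_const, integral_const_mul, integral_const_mul, integral_inner IsGaussian.integrable_fun_id,
    integral_id_stdGaussian, integral_norm_sq_stdGaussian, Fintype.card_fin]
  simp only [inner_zero_right, mul_zero, add_zero, probReal_univ, one_smul]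
  push_cast
  ring

/-- A DOMINATION HELPER: `M_{θ,u} · g` is integrable as soon as `g` is a.e.-strongly measurable and
`|g(v)| ≤ A + B |v − c|^k`. -/
theorem integrable_lM_mul_of_norm_le {θ : ℝ} (hθ : 0 < θ) (u c : V3) {g : V3 → ℝ} {A B : ℝ} {k : ℕ}
    (hg : AEStronglyMeasurable g) (hle : ∀ v, ‖g v‖ ≤ A + B * ‖v - c‖ ^ k) :
    Integrable (fun v => localMaxwellian 1 θ u v * g v) := by
  have hdom : Integrable (fun v => localMaxwellian 1 θ u v * (A + B * ‖v - c‖ ^ k)) := by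
    have h1 := (integrable_lM hθ u).mul_const A
    have h2 := (integrable_lM_mul_norm_sub_pow hθ u c k).const_mul B
    refine (h1.add h2).congr (Eventually.of_forall fun v => ?_)
    simp only [Pi.add_apply]
    ring
  refine hdom.mono' ((measurable_lM θ u).aestronglyMeasurable.mul hg) (Eventually.of_forall fun v => ?_)
  rw [norm_mul, Real.norm_eq_abs, abs_of_nonneg (localMaxwellian_nonneg zero_le_one hθ.le u v)]
  exact mul_le_mul_of_nonneg_left (hle v) (localMaxwellian_nonneg zero_le_one hθ.le u v)

/-- The fourth Gaussian moment constant is nonnegative. -/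
theorem K4_nonneg : 0 ≤ ∫ w, ‖w‖ ^ 4 ∂stdGaussian V3 :=
  integral_nonneg fun _ => by positivity


/-! ## A Gaussian envelope, uniform over bounded temperatures and centres -/

/-- GAUSSIAN ENVELOPE: for `h² ≤ θ ≤ Θ` and `|u| ≤ V`,
`M_{θ,u}(v) ≤ (2 * Real.pi * h ^ 2) ^ (-(3 : ℝ) / 2) · e^{V²/(2Θ)} · (4πΘ)^{3/2} · M_{2Θ,0}(v)` (an integrable majorant with all moments,
uniform in `(θ, u)`). -/
theorem lM_le_envelope {h θ Θ V : ℝ} {u : V3} (hh : 0 < h) (hθ : h ^ 2 ≤ θ) (hΘ : θ ≤ Θ) (hu : ‖u‖ ≤ V)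
    (v : V3) :
    localMaxwellian 1 θ u v ≤ (2 * Real.pi * h ^ 2) ^ (-(3 : ℝ) / 2) * Real.exp (V ^ 2 / (2 * Θ)) * (4 * Real.pi * Θ) ^ ((3 : ℝ) / 2) *
      localMaxwellian 1 (2 * Θ) 0 v := by
  have hθ0 : 0 < θ := lt_of_lt_of_le (by positivity) hθ
  have hΘ0 : 0 < Θ := lt_of_lt_of_le hθ0 hΘ
  have h4 : 0 < 4 * Real.pi * Θ := by positivity
  -- the exponent
  have hexp : Real.exp (-‖v - u‖ ^ 2 / (2 * θ)) ≤ Real.exp (V ^ 2 / (2 * Θ)) * Real.exp (-‖v‖ ^ 2 / (4 * Θ)) := by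
    rw [← Real.exp_add, Real.exp_le_exp]
    have h1 : ‖v - u‖ ^ 2 / (2 * Θ) ≤ ‖v - u‖ ^ 2 / (2 * θ) :=
      div_le_div_of_nonneg_left (by positivity) (by positivity) (by linarith)
    have h2 : ‖v‖ ^ 2 ≤ 2 * ‖v - u‖ ^ 2 + 2 * ‖u‖ ^ 2 := by
      have h : ‖v‖ ≤ ‖v - u‖ + ‖u‖ := by
        calc ‖v‖ = ‖(v - u) + u‖ := by rw [sub_add_cancel]
          _ ≤ ‖v - u‖ + ‖u‖ := norm_add_le _ _
      nlinarith [norm_nonneg (v - u), norm_nonneg u, norm_nonneg v, sq_nonneg (‖v - u‖ - ‖u‖)]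
    have h3 : ‖u‖ ^ 2 ≤ V ^ 2 := pow_le_pow_left₀ (norm_nonneg _) hu 2
    have key : ‖v‖ ^ 2 ≤ 2 * ‖v - u‖ ^ 2 + 2 * V ^ 2 := by linarith
    have h5 : ‖v‖ ^ 2 / (4 * Θ) ≤ (2 * ‖v - u‖ ^ 2 + 2 * V ^ 2) / (4 * Θ) :=
      div_le_div_of_nonneg_right key (by positivity)
    have h6 : (2 * ‖v - u‖ ^ 2 + 2 * V ^ 2) / (4 * Θ) = ‖v - u‖ ^ 2 / (2 * Θ) + V ^ 2 / (2 * Θ) := by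
      field_simp
      ring
    rw [neg_div, neg_div]
    linarith
  -- the right-hand Maxwellian, unfolded
  have hM2 : localMaxwellian 1 (2 * Θ) 0 v = (4 * Real.pi * Θ) ^ (-(3 : ℝ) / 2) * Real.exp (-‖v‖ ^ 2 / (4 * Θ)) := by
    simp only [localMaxwellian, finrank_V3_eq_three, Nat.cast_ofNat, one_mul]
    rw [sub_zero]
    congr 1
    · ring_nf
    · congr 1; ring
  have hcancel : (4 * Real.pi * Θ) ^ ((3 : ℝ) / 2) * (4 * Real.pi * Θ) ^ (-(3 : ℝ) / 2) = 1 := by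
    rw [← Real.rpow_add h4]; norm_num
  rw [hM2]
  simp only [localMaxwellian, finrank_V3_eq_three, Nat.cast_ofNat, one_mul]
  calc (2 * Real.pi * θ) ^ (-(3 : ℝ) / 2) * Real.exp (-‖v - u‖ ^ 2 / (2 * θ))
      ≤ (2 * Real.pi * h ^ 2) ^ (-(3 : ℝ) / 2) * (Real.exp (V ^ 2 / (2 * Θ)) * Real.exp (-‖v‖ ^ 2 / (4 * Θ))) :=
        mul_le_mul (rpow_pref_le_gMax hh hθ) hexp (Real.exp_pos _).le (gMax_pos hh).le
    _ = (2 * Real.pi * h ^ 2) ^ (-(3 : ℝ) / 2) * Real.exp (V ^ 2 / (2 * Θ)) * ((4 * Real.pi * Θ) ^ ((3 : ℝ) / 2) *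
          (4 * Real.pi * Θ) ^ (-(3 : ℝ) / 2)) * Real.exp (-‖v‖ ^ 2 / (4 * Θ)) := by rw [hcancel]; ring
    _ = _ := by ring

/-! ## The Maxwellian along a curve of temperatures and centres -/

/-- DERIVATIVE ALONG A CURVE: for differentiable `θ(·) > 0` and `u(·)`,
`d/dr M_{θ(r),u(r)}(v) = M · (θ' (|v−u|²/(2θ²) − 3/(2θ)) + ⟪v−u, u'⟫/θ)`. -/
theorem hasDerivAt_lM_comp {θ : ℝ → ℝ} {u : ℝ → V3} {θ' : ℝ} {u' : V3} {r : ℝ}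
    (hθ : HasDerivAt θ θ' r) (hu : HasDerivAt u u' r) (hpos : 0 < θ r) (v : V3) :
    HasDerivAt (fun s => localMaxwellian 1 (θ s) (u s) v)
      (localMaxwellian 1 (θ r) (u r) v *
        (θ' * (‖v - u r‖ ^ 2 / (2 * θ r ^ 2) - 3 / (2 * θ r)) + ⟪v - u r, u'⟫_ℝ / θ r)) r := by
  have h2π : 0 < 2 * Real.pi * θ r := by positivity
  have h1 : HasDerivAt (fun s => 2 * Real.pi * θ s) (2 * Real.pi * θ') r := hθ.const_mul _
  have h2 : HasDerivAt (fun s => (2 * Real.pi * θ s) ^ (-(3 : ℝ) / 2))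
      (2 * Real.pi * θ' * (-(3 : ℝ) / 2) * (2 * Real.pi * θ r) ^ (-(3 : ℝ) / 2 - 1)) r :=
    h1.rpow_const (Or.inl h2π.ne')
  have h3 : HasDerivAt (fun s => ‖v - u s‖ ^ 2) (2 * ⟪v - u r, 0 - u'⟫_ℝ) r :=
    ((hasDerivAt_const r v).sub hu).norm_sq
  have h1' : HasDerivAt (fun s => 2 * θ s) (2 * θ') r := hθ.const_mul _
  have h4 : HasDerivAt (fun s => -‖v - u s‖ ^ 2 / (2 * θ s))
      ((-(2 * ⟪v - u r, 0 - u'⟫_ℝ) * (2 * θ r) - -‖v - u r‖ ^ 2 * (2 * θ')) / (2 * θ r) ^ 2) r :=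
    h3.neg.div h1' (by positivity)
  have h5 := h2.mul h4.exp
  have hfun : (fun s => localMaxwellian 1 (θ s) (u s) v) =
      fun s => (2 * Real.pi * θ s) ^ (-(3 : ℝ) / 2) * Real.exp (-‖v - u s‖ ^ 2 / (2 * θ s)) := by
    funext s
    simp only [localMaxwellian, finrank_V3_eq_three, Nat.cast_ofNat, one_mul]
  rw [hfun]
  refine h5.congr_deriv ?_
  simp only [localMaxwellian, finrank_V3_eq_three, Nat.cast_ofNat, one_mul]
  rw [Real.rpow_sub_one h2π.ne', zero_sub, inner_neg_right]
  field_simp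
  ring

/-- BOUND OF THE DERIVATIVE for `θ ≥ h²`:
`|M · (θ'(|v−u|²/(2θ²) − 3/(2θ)) + ⟪v−u,u'⟫/θ)| ≤ M · (|θ'| (|v−u|²/(2h⁴) + 3/(2h²)) + |v−u| |u'|/h²)`. -/
theorem abs_dlM_le {h θ θ' : ℝ} {u u' : V3} (hh : 0 < h) (hθ : h ^ 2 ≤ θ) (v : V3) :
    |localMaxwellian 1 θ u v * (θ' * (‖v - u‖ ^ 2 / (2 * θ ^ 2) - 3 / (2 * θ)) + ⟪v - u, u'⟫_ℝ / θ)| ≤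
      localMaxwellian 1 θ u v *
        (|θ'| * (‖v - u‖ ^ 2 / (2 * h ^ 4) + 3 / (2 * h ^ 2)) + ‖v - u‖ * ‖u'‖ / h ^ 2) := by
  have hh2 : 0 < h ^ 2 := by positivity
  have hθ0 : 0 < θ := lt_of_lt_of_le hh2 hθ
  have hM : 0 ≤ localMaxwellian 1 θ u v := localMaxwellian_nonneg zero_le_one hθ0.le u v
  rw [abs_mul, abs_of_nonneg hM]
  refine mul_le_mul_of_nonneg_left ?_ hM
  have hA : |θ' * (‖v - u‖ ^ 2 / (2 * θ ^ 2) - 3 / (2 * θ))| ≤ |θ'| * (‖v - u‖ ^ 2 / (2 * h ^ 4) + 3 / (2 * h ^ 2)) := by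
    rw [abs_mul]
    refine mul_le_mul_of_nonneg_left ?_ (abs_nonneg _)
    have h1 : ‖v - u‖ ^ 2 / (2 * θ ^ 2) ≤ ‖v - u‖ ^ 2 / (2 * h ^ 4) := by
      refine div_le_div_of_nonneg_left (by positivity) (by positivity) ?_
      have : h ^ 4 = (h ^ 2) ^ 2 := by ring
      rw [this]
      exact mul_le_mul_of_nonneg_left (pow_le_pow_left₀ hh2.le hθ 2) zero_le_two
    have h2 : 3 / (2 * θ) ≤ 3 / (2 * h ^ 2) :=
      div_le_div_of_nonneg_left (by norm_num) (by positivity) (by linarith)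
    calc |‖v - u‖ ^ 2 / (2 * θ ^ 2) - 3 / (2 * θ)| ≤ |‖v - u‖ ^ 2 / (2 * θ ^ 2)| + |3 / (2 * θ)| := abs_sub _ _
      _ = ‖v - u‖ ^ 2 / (2 * θ ^ 2) + 3 / (2 * θ) := by
          rw [abs_of_nonneg (by positivity), abs_of_nonneg (by positivity)]
      _ ≤ _ := add_le_add h1 h2
  have hB : |⟪v - u, u'⟫_ℝ / θ| ≤ ‖v - u‖ * ‖u'‖ / h ^ 2 := by
    rw [abs_div, abs_of_pos hθ0]
    calc |⟪v - u, u'⟫_ℝ| / θ ≤ ‖v - u‖ * ‖u'‖ / θ :=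
          div_le_div_of_nonneg_right (abs_real_inner_le_norm _ _) hθ0.le
      _ ≤ ‖v - u‖ * ‖u'‖ / h ^ 2 := div_le_div_of_nonneg_left (by positivity) hh2 hθ
  exact (abs_add_le _ _).trans (add_le_add hA hB)

end EntropyBudget

/-- Registered anchor of this helper file (`--supports stmt-AtomisticToContinuum-14868`, helper of
`stub_entropyBudget`): the second moment of the unit-mass Maxwellian of `ℝ³` about any point. -/
theorem bhEntropyBudget_gauss_anchor : ∀ (θ : ℝ), 0 < θ → ∀ (u c : V3), ∫ v, Literature.Analysis.FluidPDE.localMaxwellian 1 θ u v * ‖v - c‖ ^ 2 = 3 * θ + ‖u - c‖ ^ 2 :=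
  fun _ hθ u c => EntropyBudget.integral_lM_mul_norm_sub_sq' hθ u c

end

end Summit.AtomisticToContinuum.HydrodynamicLimit.Theorems.BlockHDissipation
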